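import Summits.QuantumFields.BalabanUV.T4Continuum.Support.CTBalabanPertHbd
import Summits.QuantumFields.BalabanUV.T4Continuum.Support.CTVectorPropagator

/-!
# T⁴ programme, spine node NE2 (U1a), sub-row Δ3 «NE2-WALK» (T4-DAG `T4-U1a.S-NE2-D3-WALK°`) — THE `U = 1` INPUT `hJ` OF «Δ3-CT-HBD»
# DISCHARGED BY THE SUBSTRATE's VEC-6 (`CTVectorPropagator.conjDefect_DeltaA`): the conjugation defect of Bałaban's `Δ_a^{(k)}` at the
# canonical weights is `≤ JA d a a′ κ 1` at EVERY level, so rows B2 + B3's decay binder rests on `hreg` and NUMERIC smallness of `κ` alone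

NE2 formalisation swarm `b2b-balaban-t4-ne2-formalise-*`, leaf prover 06 (gen 3), supplier item «Δ3-CT-HJ» (follower of «Δ3-CT» p220700∕p220892,
«Δ3-CT-HBD» p221704∕p221931, «Δ3-CT-HBD-B3»; owner ruling R21 (c)).  Every END of the «Δ3-CT-HBD» chain displays
`hJ : ∀ k y, ConjDefect (Δ_a^{(k)}) κ (rho k y) J` — the `U = 1` Combes–Thomas core.  The substrate programme VEC (seat substrate-p3) HAS PROVED
it: `CTVectorPropagator.conjDefect_DeltaA` bounds the conjugation defect of `B5DeltaA169.DeltaA n M a` by `JA d a a′ κ Λ` for every `1/n`-Lipschitz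
site weight of block oscillation `≤ Λ` lifted to bonds, under the two smallness conditions `Jfree d a′ κ Λ < γ′`, `deltaK d a′ κ Λ < σ₀²` of its
gauge-term factorisation (`a′ > 0` an auxiliary mass).  Since `calDalev k = calDa n_k = DeltaA n_k M a` (`B5DeltaA169.calDa_eq_DeltaA`) and the
canonical weight IS such a lift (`CTKingTowerWeights.rho k y = bondW₀ (rhoSite k y)`, `abs_rhoSite_fineStep_le`, `abs_rhoSite_sub_le_one_of_blockOf_eq`,
`Λ = 1`):

 * §1 **`conjDefect_calDalev_rho`**: `∀ k y, ConjDefect (calDalev k) κ (rho k y) (max (JA d a a′ κ 1) 0)` — the binder `hJ`, LEVEL-UNIFORMLY, from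
   `(d, a, a′, κ)`-smallness alone;
 * §2 the ENDs of the chain WITH `hJ` FED: **`hdec_covariantLaplacian_of_regular_small`** (row B2's coupling: `hdec ⇐ hreg` + smallness),
   **`hdec_balabanPert_of_regular_small`** (`P_B`: `hdec ⇐ hreg ∧ hP₄` + smallness) and
   **`balaban_final_decayStations_of_regular_small`** — THE OWNER's ROOT-B DECAY STATIONS with `hdec` reduced to the END of record's
   binders, the gauge slot's conjugated bound `hP₄`, and the NUMERIC smallness of the rate `κ`:
   `Jfree d a′ κ 1 < gammaPs d a′`, `deltaK d a′ κ 1 < sigma0 d a′²`, `JA d a a′ κ 1 < gamD d a`, `‖t‖·K(κ) < 1`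
   (`JA`, `Jfree`, `deltaK` vanish at `κ = 0` and are continuous — `CTVectorPropagator`'s header —, so the first three hold for all small
   `κ > 0`; the fourth is a genuine small-COUPLING condition; an explicit admissible `κ(d, a, a′, …)` is NOT computed here).

HONEST FRAMING (T4-DAG p. 1).  Bookkeeping over landed modules ([folklore]); statements OURS; MODEL level (no B0); `hP₄` (row B4's gauge slot under
conjugation) STILL DISPLAYED; `hNE3`, the (3.35)-class and the threshold enter through the END of record; no explicit rate; Δ3 NOT closed (the
gauge slot; the explicit `κ`); NE2 (U1a) NOT PROVED; NE3 OPEN; spine PROVED 0/9 unchanged; NOT infinite volume, NOT a mass gap, NOT the Clay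
problem, NOT summit progress.  HONEST DEPENDENCY: continuum YM on T⁴ ⇐ BetaPertH ∧ nine spine estimates (0/9 proved); BetaPertH ⇐ (D1) ∧ (D4) ∧
CAP+tail; G-an2-4 gates asym, D1 and NE2/3/4.  ABSOLUTE RULE kept; no `sorry`.
-/

noncomputable section

open scoped BigOperators ComplexConjugate Matrix Matrix.Norms.L2Operator Kronecker

namespace Summit.QuantumFields.BalabanUV.T4Continuum.CTConjDefectDischarge

open Literature.MathematicalPhysics.QuantumFieldTheory.Balaban1983to89.B5Prop11Plancherel (Cst Cst_nonneg Tor fine)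
open Literature.MathematicalPhysics.QuantumFieldTheory.Balaban1983to89.B5G183RateUnitTower (lev lev_neZero)
open Literature.MathematicalPhysics.QuantumFieldTheory.Balaban1983to89.B5DeltaA169 (DeltaA calDa_eq_DeltaA)
open Literature.MathematicalPhysics.QuantumFieldTheory.Balaban1983to89.T4EtaRateMin (LocalRate)
open Summit.QuantumFields.BalabanUV.T4Continuum
open Summit.QuantumFields.BalabanUV.T4Continuum.BalabanAveragedTowerUnit (idx one_le_lev')
open Summit.QuantumFields.BalabanUV.T4Continuum.BackgroundResolventTower
open Summit.QuantumFields.BalabanUV.T4Continuum.KingPairingPlantedLaw (calDalev CJ)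
open Summit.QuantumFields.BalabanUV.T4Continuum.GramPerturbationLaw (C2gram)
open Summit.QuantumFields.BalabanUV.T4Continuum.NE2FromNE3 (bgReadings)
open Summit.QuantumFields.BalabanUV.T4Continuum.NE2ColourPerturbedLayer (pertCovC pertLimC)
open Summit.QuantumFields.BalabanUV.T4Continuum.RegularBackgroundTower (RegularTransporters regClass betaNE3)
open Summit.QuantumFields.BalabanUV.T4Continuum.GaugeTermScalarData (QuT Q1)
open Summit.QuantumFields.BalabanUV.T4Continuum.RegularSiteTransporters (siteT)
open Summit.QuantumFields.BalabanUV.T4Continuum.NestedContourTransport (theta0)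
open Summit.QuantumFields.BalabanUV.T4Continuum.NE2BalabanRoot (balabanPert)
open Summit.QuantumFields.BalabanUV.T4Continuum.NE2BalabanGauge (gaugeSlot liftR)
open Summit.QuantumFields.BalabanUV.T4Continuum.NE2BalabanLayerSharp (kappaBs C2Bs)
open Summit.QuantumFields.BalabanUV.T4Continuum.NE2BalabanWiring (epsR CdeltaR)
open Summit.QuantumFields.BalabanUV.T4Continuum.NE2BalabanFinal (kappa4F C4F)
open Summit.QuantumFields.BalabanUV.T4Continuum.NE2BalabanThreshold (etaStar)
open Summit.QuantumFields.BalabanUV.T4Continuum.DecayRateInterpolation (EntryDecay DecayRate TwoLevelDecayRate)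
open Summit.QuantumFields.BalabanUV.T4Continuum.ColourCovariantLaplacian (covPertC)
open Summit.QuantumFields.BalabanUV.T4Continuum.ScalarAveragedPropagator (gammaPs)
open Summit.QuantumFields.BalabanUV.T4Continuum.ScalarAveragedCompression (sigma0)
open Summit.QuantumFields.BalabanUV.T4Continuum.CTWeightedCoercivity
open Summit.QuantumFields.BalabanUV.T4Continuum.CTScalarGreen (Jfree)
open Summit.QuantumFields.BalabanUV.T4Continuum.CTGaugeTerm (deltaK)
open Summit.QuantumFields.BalabanUV.T4Continuum.CTVectorPropagator (JA conjDefect_DeltaA)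
open Summit.QuantumFields.BalabanUV.T4Continuum.CTKingTowerWeights (rho rhoSite distKC abs_rhoSite_fineStep_le abs_rhoSite_sub_le_one_of_blockOf_eq)
open Summit.QuantumFields.BalabanUV.T4Continuum.CTCovariantLaplacianDecay (kappaColCT hdec_covariantLaplacian_of_regular)
open Summit.QuantumFields.BalabanUV.T4Continuum.CTAveragingSummandHbd (kappaAvgCT)
open Summit.QuantumFields.BalabanUV.T4Continuum.CTBalabanPertHbd (hdec_balabanPert_of_regular balaban_final_decayStations_of_regular_of_conjDefect)
open Summit.QuantumFields.BalabanUV.T4Continuum.DirichletRegionTower (gamD gamD_pos)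

variable {d : ℕ} (L : ℕ) [NeZero L] (M : Fin d → ℕ) [hM : ∀ μ, NeZero (M μ)] (a : ℝ) (ha : 0 < a)
variable {o : Type*} [Fintype o] [DecidableEq o]

/-! ## §1 The binder `hJ` from the substrate's VEC-6 -/

/-- **THE `U = 1` CONJUGATION DEFECT OF `Δ_a^{(k)}` AT THE CANONICAL WEIGHTS, AT EVERY LEVEL**: for an auxiliary mass `a′ > 0` and a rate `κ` with
`Jfree d a′ κ 1 < γ′` and `deltaK d a′ κ 1 < σ₀²`, `ConjDefect (calDalev k) κ (rho k y) (max (JA d a a′ κ 1) 0)` — the binder `hJ` of the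
«Δ3-CT-HBD» chain, from `CTVectorPropagator.conjDefect_DeltaA` BY NAME (`calDa_eq_DeltaA`; `rho k y = bondW₀ (rhoSite k y)` is `1/n_k`-Lipschitz with
block oscillation `≤ 1`). [folklore] -/
theorem conjDefect_calDalev_rho {a' κ : ℝ} (ha' : 0 < a') (hγ' : Jfree d a' κ 1 < gammaPs d a') (hδ' : deltaK d a' κ 1 < sigma0 d a' ^ 2)
    (k : ℕ) (y : idx L M 0) : ConjDefect (calDalev L M a ha k) κ (rho L M k y) (max (JA d a a' κ 1) 0) := by
  have h := conjDefect_DeltaA (lev L k) M (a := a) (ρ₀ := rhoSite L M k y) ha' zero_le_one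
    (fun x ν => abs_rhoSite_fineStep_le L M k y x ν) (fun x x' hx => abs_rhoSite_sub_le_one_of_blockOf_eq L M k y x x' hx) hγ' hδ'
  rw [calDalev, calDa_eq_DeltaA]
  exact h.mono (le_max_left _ _)

/-- the smallness `JA < γ_D` in the `max`-form used by the ENDs. [folklore] -/
theorem max_JA_lt_gamD {a' κ : ℝ} (hJA : JA d a a' κ 1 < gamD d a) : max (JA d a a' κ 1) 0 < gamD d a :=
  max_lt hJA (gamD_pos (d := d) a)

/-! ## §2 The ENDs of the chain with `hJ` fed -/

/-- **ROW B2's DECAY BINDER FROM `hreg` AND NUMERIC SMALLNESS ALONE**: on the (3.35)-class, for `κ ≥ 0` with the three smallness conditions and a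
coupling with `‖t‖·κ_CT < 1`, `∀ k, EntryDecay distKC (pertCovC (covPertC R) t k) ((γ_D − J)⁻¹(1 − ‖t‖κ_CT)⁻¹e^{2κ}) κ`, `J = max (JA d a a′ κ 1) 0`.
NO displayed Combes–Thomas input. [folklore] -/
theorem hdec_covariantLaplacian_of_regular_small {R : (k : ℕ) → Fin d → (idx L M k → Matrix o o ℂ)} {α β : ℝ}
    (hreg : RegularTransporters L M R α β) {a' κ : ℝ} (ha' : 0 < a') (hκ : 0 ≤ κ) (hγ' : Jfree d a' κ 1 < gammaPs d a')
    (hδ' : deltaK d a' κ 1 < sigma0 d a' ^ 2) (hJA : JA d a a' κ 1 < gamD d a) {t : ℂ}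
    (ht : ‖t‖ * kappaColCT o d a α β (d * (α ^ 2 + 2 * β)) (max (JA d a a' κ 1) 0) κ < 1) (k : ℕ) :
    EntryDecay (distKC L M o) (pertCovC L M a ha (covPertC L M R) t k)
      ((gamD d a - max (JA d a a' κ 1) 0)⁻¹ * (1 - ‖t‖ * kappaColCT o d a α β (d * (α ^ 2 + 2 * β)) (max (JA d a a' κ 1) 0) κ)⁻¹
        * Real.exp (κ * 2)) κ :=
  hdec_covariantLaplacian_of_regular L M a ha hreg hκ (conjDefect_calDalev_rho L M a ha ha' hγ' hδ') (le_max_right _ _)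
    (max_JA_lt_gamD a hJA) ht k

/-- **THE `P_B`-COUPLED TOWER's DECAY BINDER FROM `hreg`, THE GAUGE SLOT's `hP₄` AND NUMERIC SMALLNESS** (`K = κ_CT + κ_avg,CT + κ₄`). [folklore] -/
theorem hdec_balabanPert_of_regular_small {R : (k : ℕ) → Fin d → (idx L M k → Matrix o o ℂ)} {α β : ℝ}
    (hreg : RegularTransporters L M R α β) {a' κ : ℝ} (ha' : 0 < a') (hκ : 0 ≤ κ) (hγ' : Jfree d a' κ 1 < gammaPs d a')
    (hδ' : deltaK d a' κ 1 < sigma0 d a' ^ 2) (hJA : JA d a a' κ 1 < gamD d a)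
    {P₄ : (k : ℕ) → Matrix (idx L M k × o) (idx L M k × o) ℂ} {κ₄ : ℝ}
    (hP₄ : ∀ (k : ℕ) (y : idx L M 0 × o),
      ‖conjMat κ (fun p : idx L M k × o => rho L M k y.1 p.1) (fun p : idx L M k × o => rho L M k y.1 p.1) (P₄ k)
        * conjMat κ (fun p : idx L M k × o => rho L M k y.1 p.1) (fun p : idx L M k × o => rho L M k y.1 p.1)
          (calDalev L M a ha k ⊗ₖ (1 : Matrix o o ℂ))⁻¹‖ ≤ κ₄)
    {t : ℂ} (ht : ‖t‖ * (kappaColCT o d a α β (d * (α ^ 2 + 2 * β)) (max (JA d a a' κ 1) 0) κ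
      + kappaAvgCT (Fintype.card o) d a α (max (JA d a a' κ 1) 0) κ + κ₄) < 1) (k : ℕ) :
    EntryDecay (distKC L M o) (pertCovC L M a ha (balabanPert L M a R P₄) t k)
      ((gamD d a - max (JA d a a' κ 1) 0)⁻¹ * (1 - ‖t‖ * (kappaColCT o d a α β (d * (α ^ 2 + 2 * β)) (max (JA d a a' κ 1) 0) κ
        + kappaAvgCT (Fintype.card o) d a α (max (JA d a a' κ 1) 0) κ + κ₄))⁻¹ * Real.exp (κ * 2)) κ :=
  hdec_balabanPert_of_regular L M a ha hreg hκ (conjDefect_calDalev_rho L M a ha ha' hγ' hδ') (le_max_right _ _)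
    (max_JA_lt_gamD a hJA) hP₄ ht k

/-- **ROOT B IN THE DECAY CURRENCY, MODULO THE GAUGE SLOT's CONJUGATED BOUND AND NUMERIC SMALLNESS OF THE RATE** (`L ≥ 2`, `d ≥ 1`): the owner's
`NE2BalabanDecayRate.balaban_final_decayStations_of_regular` — every binder of the END of record — with its displayed `hdec` FED by «Δ3-CT» +
«Δ3-CT-HBD» + «Δ3-CT-HBD-B3» + the substrate's VEC-6: beyond the END of record's binders ONLY `hP₄` (row B4's gauge slot under conjugation), an
auxiliary mass `a″ > 0`, and the four numeric conditions on `κ` remain.  Model level; CONDITIONAL on NE3 + the (3.35)-class + the threshold + `hP₄`;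
NE2 (U1a) is NOT proved by this. [cite: King1986, Lemma 4.5 (4.38) p.674 (shape); Balaban1985BackgroundPropagators, Thm 3.4 p.400 (shape)] [folklore] -/
theorem balaban_final_decayStations_of_regular_small (hL : 2 ≤ L) (hd : 1 ≤ d)
    {Rg : (k : ℕ) → Fin d → (Tor (fine (lev L k) M) → Matrix o o ℂ)}
    {α β : ℝ} (hreg : RegularTransporters L M (liftR L M Rg) α β) {C : ℝ} (hC : 0 ≤ C)
    (hNE3 : LocalRate (bgReadings L M (regClass L M (liftR L M Rg))) C ((L : ℝ)⁻¹)) {a' : ℝ} (ha' : 0 < a')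
    {η : ℝ} (hαη : α ≤ η) (hβη : β ≤ η) (hη : η ≤ etaStar o d a a') {t : ℂ} (ht : ‖t‖ ≤ 1)
    {a'' κ : ℝ} (ha'' : 0 < a'') (hκ : 0 ≤ κ) (hγ' : Jfree d a'' κ 1 < gammaPs d a'') (hδ' : deltaK d a'' κ 1 < sigma0 d a'' ^ 2)
    (hJA : JA d a a'' κ 1 < gamD d a) {κ₄ : ℝ}
    (hP₄ : ∀ (k : ℕ) (y : idx L M 0 × o),
      ‖conjMat κ (fun p : idx L M k × o => rho L M k y.1 p.1) (fun p : idx L M k × o => rho L M k y.1 p.1)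
          (gaugeSlot L M Rg (QuT L M o (siteT L M Rg)) (Q1 L M o) a' k)
        * conjMat κ (fun p : idx L M k × o => rho L M k y.1 p.1) (fun p : idx L M k × o => rho L M k y.1 p.1)
          (calDalev L M a ha k ⊗ₖ (1 : Matrix o o ℂ))⁻¹‖ ≤ κ₄)
    (htK : ‖t‖ * (kappaColCT o d a α β (d * (α ^ 2 + 2 * β)) (max (JA d a a'' κ 1) 0) κ
      + kappaAvgCT (Fintype.card o) d a α (max (JA d a a'' κ 1) 0) κ + κ₄) < 1) :
    EntryDecay (distKC L M o)
        (pertLimC L M a ha (balabanPert L M a (liftR L M Rg) (gaugeSlot L M Rg (QuT L M o (siteT L M Rg)) (Q1 L M o) a')) t)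
        ((gamD d a - max (JA d a a'' κ 1) 0)⁻¹ * (1 - ‖t‖ * (kappaColCT o d a α β (d * (α ^ 2 + 2 * β)) (max (JA d a a'' κ 1) 0) κ
          + kappaAvgCT (Fintype.card o) d a α (max (JA d a a'' κ 1) 0) κ + κ₄))⁻¹ * Real.exp (κ * 2)) κ ∧
      DecayRate (distKC L M o)
        (pertCovC L M a ha (balabanPert L M a (liftR L M Rg) (gaugeSlot L M Rg (QuT L M o (siteT L M Rg)) (Q1 L M o) a')) t)
        (pertLimC L M a ha (balabanPert L M a (liftR L M Rg) (gaugeSlot L M Rg (QuT L M o (siteT L M Rg)) (Q1 L M o) a')) t)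
        (Real.sqrt (2 * ((gamD d a - max (JA d a a'' κ 1) 0)⁻¹
            * (1 - ‖t‖ * (kappaColCT o d a α β (d * (α ^ 2 + 2 * β)) (max (JA d a a'' κ 1) 0) κ
              + kappaAvgCT (Fintype.card o) d a α (max (JA d a a'' κ 1) 0) κ + κ₄))⁻¹ * Real.exp (κ * 2)) *
          (Cpert (kappaBs o d a α β (a * (epsR o d α * (2 + epsR o d α) * Cst d a)) (kappa4F d a a' α β)) (2 * d * Cst d a) (CJ d a)
              (C2Bs o d L a α β C
                (a * C2gram (Cst d a) 1 (epsR o d α) (2 * d * Cst d a) (CJ d a) (Cst d a) (CdeltaR o d a α (theta0 d α (betaNE3 o C))))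
                (C4F o d L a a' α β C)) 0 t / (1 - (L : ℝ)⁻¹))))
        (κ / 2) (Real.sqrt ((L : ℝ)⁻¹)) ∧
      TwoLevelDecayRate (distKC L M o)
        (pertCovC L M a ha (balabanPert L M a (liftR L M Rg) (gaugeSlot L M Rg (QuT L M o (siteT L M Rg)) (Q1 L M o) a')) t)
        (Real.sqrt (2 * ((gamD d a - max (JA d a a'' κ 1) 0)⁻¹
            * (1 - ‖t‖ * (kappaColCT o d a α β (d * (α ^ 2 + 2 * β)) (max (JA d a a'' κ 1) 0) κ
              + kappaAvgCT (Fintype.card o) d a α (max (JA d a a'' κ 1) 0) κ + κ₄))⁻¹ * Real.exp (κ * 2)) * (2 *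
          Cpert (kappaBs o d a α β (a * (epsR o d α * (2 + epsR o d α) * Cst d a)) (kappa4F d a a' α β)) (2 * d * Cst d a) (CJ d a)
              (C2Bs o d L a α β C
                (a * C2gram (Cst d a) 1 (epsR o d α) (2 * d * Cst d a) (CJ d a) (Cst d a) (CdeltaR o d a α (theta0 d α (betaNE3 o C))))
                (C4F o d L a a' α β C)) 0 t / (1 - (L : ℝ)⁻¹))))
        (κ / 2) (Real.sqrt ((L : ℝ)⁻¹)) :=
  balaban_final_decayStations_of_regular_of_conjDefect L M a ha hL hd hreg hC hNE3 ha' hαη hβη hη ht hκ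
    (conjDefect_calDalev_rho L M a ha ha'' hγ' hδ') (le_max_right _ _) (max_JA_lt_gamD a hJA) hP₄ htK

end Summit.QuantumFields.BalabanUV.T4Continuum.CTConjDefectDischarge

end
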